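import Literature.Probability.Process.PlanarBrownianVec
import Literature.Probability.RandomPlanarGeometry.BrownianLoopMeasure
import HarnessLib

/-!
# Planar Brownian motion: an event of the past up to time `T < 1` and a small endpoint `Z_1`

Proof file (theorems only). For the planar Brownian motion of the pair (`Process.isBrownianVec_planar`
on `(WienerPair, wienerPair)`), an event `E` of the natural filtration at time `T < 1` and `η ≥ 0`,

* `measure_inter_endpoints_small_le` —
  **`P(E ∩ {|B¹_1| ≤ η, |B²_1| ≤ η}) ≤ (2η/√(2π(1 − T)))² · P(E)`**:

the increment `Z_1 − Z_T` is independent of `𝓕_T` with law `N(0, (1 − T) I₂)`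
(`IsBrownianVec.integral_indicator_mul_comp_incr`, the weak Markov property in its "freezing" form),
and a Gaussian vector puts mass at most `(2η/√(2πh))²` on any sup-norm ball of radius `η`
(`Process.gaussVec_closedBall_le`). This recovers the factor `η²` lost when a Brownian-bridge event
is transferred to a Brownian event by conditioning on a small endpoint
(`BrownianBridgeTransfer`). No definition and no named fact is introduced.

## References

* J.-F. Le Gall, *Brownian Motion, Martingales, and Stochastic Calculus*, GTM 274 (2016), Ch. 2
  (simple Markov property). [Legall2016]
-/

noncomputable section

open MeasureTheory ProbabilityTheory Filter Set Metric
open scoped NNReal ENNReal Topology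

namespace Literature.Probability.RandomPlanarGeometry

open Literature.Probability.Process

/-- **A past event and a small endpoint.** For `T < 1`, `E ∈ 𝓕_T` (natural filtration of the planar
Brownian motion of the pair) and `η ≥ 0`,
`P(E ∩ {|B¹_1| ≤ η, |B²_1| ≤ η}) ≤ (2η/√(2π(1 − T)))² · P(E)`.
[cite: Legall2016, Ch. 2 (simple Markov property of Brownian motion)] -/
theorem measure_inter_endpoints_small_le {T : ℝ≥0} (hT : T < 1) {E : Set WienerPair}
    (hE : MeasurableSet[isBrownianVec_planar.natFiltration T] E) {η : ℝ} (hη : 0 ≤ η) :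
    wienerPair (E ∩ {ω | |brownian 1 ω.1| ≤ η ∧ |brownian 1 ω.2| ≤ η}) ≤
      ENNReal.ofReal ((2 * η * (Real.sqrt (2 * Real.pi * ((1 - T : ℝ≥0) : ℝ)))⁻¹) ^ 2) * wienerPair E := by
  set W : ℝ≥0 → WienerPair → (Fin 2 → ℝ) := fun t ω ↦ ![brownian t ω.1, brownian t ω.2] with hWdef
  have hW : IsBrownianVec W wienerPair := isBrownianVec_planar
  have hEm : MeasurableSet E := hW.natFiltration.le T _ hE
  set h : ℝ≥0 := 1 - T with hhdef
  have hh0 : h ≠ 0 := (tsub_pos_of_lt hT).ne'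
  have hTh : T + h = 1 := add_tsub_cancel_of_le hT.le
  -- the test function: indicator of `‖y + e‖ ≤ η`
  classical
  set φ : (Fin 2 → ℝ) × (Fin 2 → ℝ) → ℝ := fun p ↦ if ‖p.1 + p.2‖ ≤ η then 1 else 0 with hφdef
  have hφm : Measurable φ := by
    refine Measurable.ite ?_ measurable_const measurable_const
    exact measurableSet_le (measurable_fst.add measurable_snd).norm measurable_const
  have hφC : ∀ p, |φ p| ≤ 1 := fun p ↦ by
    simp only [hφdef]; split_ifs <;> simp
  have key := hW.integral_indicator_mul_comp_incr (r := T) (h := h) hE hφm hφC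
  -- the left-hand side is `P(E ∩ small)`
  set small : Set WienerPair := {ω | |brownian 1 ω.1| ≤ η ∧ |brownian 1 ω.2| ≤ η} with hsmall
  have hsmall_eq : small = {ω | ‖W 1 ω‖ ≤ η} := by
    ext ω
    simp only [hsmall, hWdef, mem_setOf_eq, pi_norm_le_iff_of_nonneg hη, Fin.forall_fin_two,
      Real.norm_eq_abs]
    simp
  have hsm : MeasurableSet small := by
    rw [hsmall_eq]; exact measurableSet_le (hW.measurable 1).norm measurable_const
  have hLHS : ∀ ω, E.indicator (fun _ ↦ (1 : ℝ)) ω * φ (W T ω, W (T + h) ω - W T ω) =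
      (E ∩ small).indicator (fun _ ↦ (1 : ℝ)) ω := by
    intro ω
    rw [hTh]
    have : W T ω + (W 1 ω - W T ω) = W 1 ω := by abel
    simp only [hφdef, this]
    by_cases hωE : ω ∈ E
    · by_cases hωs : ω ∈ small
      · have : ‖W 1 ω‖ ≤ η := by rw [hsmall_eq] at hωs; exact hωs
        simp [hωE, hωs, this]
      · have : ¬ ‖W 1 ω‖ ≤ η := by rw [hsmall_eq] at hωs; exact hωs
        simp [hωE, hωs, this]
    · simp [hωE]
  -- the right-hand side is at most `bound * P(E)`
  set bound : ℝ := (2 * η * (Real.sqrt (2 * Real.pi * (h : ℝ)))⁻¹) ^ 2 with hbound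
  have hbound0 : 0 ≤ bound := sq_nonneg _
  have hinner : ∀ y : Fin 2 → ℝ, ∫ e, φ (y, e) ∂gaussVec 2 h ≤ bound := by
    intro y
    have hset : ∀ e : Fin 2 → ℝ, φ (y, e) = (closedBall (-y) η).indicator (fun _ ↦ (1 : ℝ)) e := by
      intro e
      simp only [hφdef, indicator, mem_closedBall, dist_eq_norm]
      have : e - -y = y + e := by abel
      rw [this]
    simp_rw [hset]
    rw [integral_indicator_const _ measurableSet_closedBall, smul_eq_mul, mul_one, measureReal_def]
    have h1 := gaussVec_closedBall_le (d := 2) hh0 (-y) hη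
    have h2 := ENNReal.toReal_mono ENNReal.ofReal_ne_top h1
    rwa [ENNReal.toReal_ofReal (by positivity)] at h2
  have hRHS : ∫ ω, E.indicator (fun _ ↦ (1 : ℝ)) ω * ∫ e, φ (W T ω, e) ∂gaussVec 2 h ∂wienerPair ≤
      bound * wienerPair.real E := by
    calc ∫ ω, E.indicator (fun _ ↦ (1 : ℝ)) ω * ∫ e, φ (W T ω, e) ∂gaussVec 2 h ∂wienerPair
        ≤ ∫ ω, E.indicator (fun _ ↦ bound) ω ∂wienerPair := by
          refine integral_mono_of_nonneg (ae_of_all _ fun ω ↦ ?_) ((integrable_const bound).indicator hEm)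
            (ae_of_all _ fun ω ↦ ?_)
          · refine mul_nonneg (indicator_nonneg (fun _ _ ↦ zero_le_one) _) ?_
            exact integral_nonneg fun e ↦ by simp only [hφdef]; split_ifs <;> norm_num
          · by_cases hω : ω ∈ E
            · simp only [hω, indicator_of_mem, one_mul]
              exact hinner _
            · simp [hω]
      _ = bound * wienerPair.real E := by
          rw [integral_indicator_const _ hEm, smul_eq_mul, mul_comm]
  -- assemble
  have hreal : wienerPair.real (E ∩ small) ≤ bound * wienerPair.real E := by
    have : ∫ ω, (E ∩ small).indicator (fun _ ↦ (1 : ℝ)) ω ∂wienerPair ≤ bound * wienerPair.real E := by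
      rw [← integral_congr_ae (ae_of_all _ hLHS), key]
      exact hRHS
    rwa [integral_indicator_const _ (hEm.inter hsm), smul_eq_mul, mul_one] at this
  calc wienerPair (E ∩ small) = ENNReal.ofReal (wienerPair.real (E ∩ small)) := by
        rw [measureReal_def, ENNReal.ofReal_toReal (measure_ne_top _ _)]
    _ ≤ ENNReal.ofReal (bound * wienerPair.real E) := ENNReal.ofReal_le_ofReal hreal
    _ = ENNReal.ofReal bound * wienerPair E := by
        rw [ENNReal.ofReal_mul hbound0, measureReal_def, ENNReal.ofReal_toReal (measure_ne_top _ _)]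

end Literature.Probability.RandomPlanarGeometry

end
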